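import Summits.QuantumFields.YangMills.Theorems.BalabanUVNodesN15KingModelAnalyticDeterminantVolumeLawFull
import Summits.QuantumFields.YangMills.Theorems.BalabanUVNodesN15KingModelAnalyticDeterminantFlat
import HarnessLib

/-!
# BalabanUVNodes ∕ N15 — THE KING-MODEL RUNG (PART Ϯ-d): THE VOLUME LAW FOR NE2's UNIT-LAYER NORMALISATION — LOCALITY OF THE BLOCK-FIELD VACUUM ENERGY `ln det Δ_eff(U)`:
# if two unitary backgrounds agree off the bond set `Z`, `|ln det Δ_eff(U) − ln det Δ_eff(V)| ≤ (8c|n|²·G(0,0) + a|n|∕m²)·#Z` (King's `ln[Z(U)Z(V)⁻¹]` of (3.89)–(3.90) in the one-level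
# model is LOCAL in the background, with the constant carried by King's coincident-point covariance `c·G(0,0)`); `ln 𝒩(Δ_eff)` moves by half of it; relative to King's CLOSED FORM at
# `U ≡ 1` the deviation is `O(#supp(U ≠ 1))`, not `O(N)`
# (Track A, DAG node N15 = NE2; FAN-OUT v1.1 §N15 s3 «KING-MODEL RUNG … + what the curved case adds»; count-neutral)

HONEST FRAMING.  Count-neutral (cell `pub-ymgap`, seat `pub-ymgap-dag-n15-e` g54; `--supports stmt-QuantumFields-27247 --as helper` = K3ᴬ, KEY MAP v3).  King's one-level comparison model:
`Δ_eff(U) = a − a²Q(U)A₀(U)⁻¹Q(U)^*` (Ϥ-k `effLapU`) on one finite torus `Tor (fine L M)` per spacing, Bałaban's covariant block mean along a tree contour system, `a > 0`, `c ≥ 0`,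
`m² > 0`, unitary `U, V`, any fibre.  NOT King's multi-step `Z_k(A)` as printed (same SHAPE, one level); NOT the loop expansion (3.97)–(3.98); NOT Bałaban's (3.42); NOT a node discharge
(N15 of record untouched); nothing continuum ∕ ℝ⁴ ∕ OS ∕ Clay.

THE MECHANISM.  Ϭ-a `log_re_det_effLapU_eq`: `ln det Δ_eff(U) = N·ln a + ln det M_U − ln det A₀(U)` at every unitary `U`; hence the block-field shift is the fine shift (PART Ϯ-b, `≤ 4c|n|²G(0,0)·#Z`)
minus the full shift (PART Ϯ-c, `≤ (4c|n|²G(0,0) + a|n|∕m²)·#Z`).  WHAT THE CURVED CASE ADDS, QUANTIFIED LOCALLY: at `U ≡ 1` King's closed form `ln det Δ_eff(1) = |n|Σ_q ln effSym(q)`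
(Ϭ-i); a background supported on `Z` moves it by at most `(8c|n|²G(0,0) + a|n|∕m²)·#Z` — versus Ϭ-b's GLOBAL `N·ln(1+a∕m²)`; the better of the two holds (§1 `…_min`).

CONTENT.  §1 ★★★ `abs_log_re_det_effLapU_sub_le_local` (ℓ¹ + block form), ★★★★ **`abs_log_re_det_effLapU_sub_le_volume`** (`≤ (8c|n|²G(0,0) + a|n|∕m²)·#Z`), ★ `…_volume_mass` (crude
`G(0,0) ≤ 1∕m²`), ★★ `…_volume_min` (with Ϭ-b's global bound), ★★★ **`abs_log_re_det_effLapU_sub_closedForm_le_volume`** (King's scaling `c = L²`: relative to the CLOSED FORM, `O(#supp)`);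
§2 (`𝕜 = ℝ`) ★★★ `abs_log_gaussNorm_effLapU_sub_le_volume` (King's `E₀ = ln 𝒩(Δ_eff)`, (3.89), moves by `≤ ½(8c|n|²G(0,0) + a|n|∕m²)·#Z`); §3 ★★★★ **`king_volume_law_package`** (the three
normalisations `det M_U`, `det A₀(U)`, `det Δ_eff(U)` by name).

PRIOR TREE ART (by name, not restated): Ϯ-b `abs_log_re_det_covLapF_sub_le_l1`∕`_le_volume`∕`sum_norm_link_sub_le_of_eqOn`, Ϯ-c `abs_log_re_det_fullOpU_sub_le`∕`_le_volume`, Ϭ-a `log_re_det_effLapU_eq`,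
Ϭ-b `abs_log_re_det_effLapU_sub_le`∕`log_gaussNorm_effLapU`, Ϭ-i `log_re_det_effLapU_flat`∕`flat_mem_unitaryGroup`, Ε-e `lapF_inv_diag_le_inv_mass`, Ͱ-b `lapF_inv_entry_nonneg`.
Dedup (rg at filing): basename 0 files; `abs_log_re_det_effLapU_sub_le_local|abs_log_re_det_effLapU_sub_le_volume|abs_log_re_det_effLapU_sub_closedForm_le_volume|abs_log_gaussNorm_effLapU_sub_le_volume|king_volume_law_package` 0 tree files.
Locators: [King1986] (2.13)–(2.16) p.653, (3.89)–(3.90) pp.668–669, (4.4)–(4.5) p.670, (4.33) p.674; [Balaban1985BackgroundPropagators] (3.19) p.393, (3.23)–(3.25) p.394, (3.42) p.397.  0 `sorry`, 0 `def`.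
-/

noncomputable section

open scoped BigOperators ComplexConjugate ComplexOrder Matrix.Norms.L2Operator
open Finset Matrix WithLp

namespace Summit.QuantumFields.YangMills.BalabanUVNodes.N15KingModelRung.Analytic

open Literature.MathematicalPhysics.QuantumFieldTheory.Balaban1983to89.B5Prop11Plancherel (Tor fine)
open Literature.MathematicalPhysics.QuantumFieldTheory.King1986.Torus (lapF effSym)
open Summit.QuantumFields.YangMills.BalabanUVNodes.N15KingModelRung.Covariant (covLapF lapF_inv_entry_nonneg)
open Summit.QuantumFields.YangMills.BalabanUVNodes.N15KingModelRung.TorusSpectral (lapF_inv_diag_le_inv_mass)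
open Summit.QuantumFields.YangMills.BalabanUVNodes.N15KingModelRung.CovariantBlock (BlockTree fullOpU effLapU)
open Summit.QuantumFields.YangMills.BalabanUVNodes.N15KingModelRung.FreeField (gaussNorm)

variable {d : ℕ} {L : ℕ} [NeZero L] (T : BlockTree d L) (M : Fin (d + 1) → ℕ) [hM : ∀ μ, NeZero (M μ)]

/-! ## §1 The volume law for `ln det Δ_eff(U)` -/

section BlockField

variable {𝕜 : Type*} [RCLike 𝕜] {n : Type*} [Fintype n] [DecidableEq n]
variable {a c m2 : ℝ} (ha : 0 < a) (hc : 0 ≤ c) (hm : 0 < m2)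
variable {U V : Tor (fine L M) × Fin (d + 1) → Matrix n n 𝕜} (hU : ∀ bd, U bd ∈ Matrix.unitaryGroup n 𝕜) (hV : ∀ bd, V bd ∈ Matrix.unitaryGroup n 𝕜)
include ha hc hm hU hV

/-- ★★★ **THE BLOCK-FIELD SHIFT, ℓ¹ + BLOCK FORM**: if `U = V` off `Z`, `|ln det Δ_eff(U) − ln det Δ_eff(V)| ≤ 4c·G(0,0)·‖U−V‖_{ℓ¹} + a|n|·#Z∕m²` — Ϭ-a's split `ln det Δ_eff = N ln a + ln det M − ln det A₀`
with PART Ϯ-b for the fine shift and PART Ϯ-c for the full shift. [cite: King1986, (2.13)–(2.14) p.653, (3.89)–(3.90) pp.668–669; Balaban1985BackgroundPropagators, (3.23)–(3.25) p.394, (3.42) p.397] -/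
theorem abs_log_re_det_effLapU_sub_le_local {Z : Finset (Tor (fine L M) × Fin (d + 1))} (hZ : ∀ bd, bd ∉ Z → U bd = V bd) :
    |Real.log (RCLike.re (effLapU T M a c m2 U).det) - Real.log (RCLike.re (effLapU T M a c m2 V).det)|
      ≤ 4 * c * (lapF (fine L M) c m2)⁻¹ 0 0 * (∑ b, ∑ i, ∑ j, ‖U b i j - V b i j‖) + a * ((Fintype.card n : ℝ) * Z.card * m2⁻¹) := by
  have hU' := log_re_det_effLapU_eq T M ha hc hm hU
  have hV' := log_re_det_effLapU_eq T M ha hc hm hV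
  have h1 := abs_log_re_det_covLapF_sub_le_l1 (fine L M) hc hm hU hV
  have h2 := abs_log_re_det_fullOpU_sub_le T M ha.le hc hm hU hV hZ
  have e : Real.log (RCLike.re (effLapU T M a c m2 U).det) - Real.log (RCLike.re (effLapU T M a c m2 V).det)
      = (Real.log (RCLike.re (covLapF (fine L M) c m2 U).det) - Real.log (RCLike.re (covLapF (fine L M) c m2 V).det))
        - (Real.log (RCLike.re (fullOpU T M a c m2 U).det) - Real.log (RCLike.re (fullOpU T M a c m2 V).det)) := by
    rw [hU', hV']; ring
  rw [e]
  refine (abs_sub _ _).trans ?_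
  linarith

/-- ★★★★ **THE VOLUME LAW FOR NE2's UNIT-LAYER NORMALISATION**: if two unitary backgrounds agree off the bond set `Z`, then
`|ln det Δ_eff(U) − ln det Δ_eff(V)| ≤ (8c|n|²·G(0,0) + a|n|∕m²)·#Z` — King's `ln[Z(U)Z(V)⁻¹]` for the block-field normalisation ((3.89)–(3.90), one level) is LOCAL in the background: the cost is
proportional to the number of changed bonds, with King's coincident-point covariance `c·G(0,0)` as the constant, NOT to the `N = |T₁||n|` degrees of freedom of Ϭ-b's global bound.
[cite: King1986, (2.13)–(2.14) p.653, (3.89)–(3.90) pp.668–669, (4.4)–(4.5) p.670; Balaban1985BackgroundPropagators, (3.19) p.393, (3.23)–(3.25) p.394, (3.42) p.397] -/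
theorem abs_log_re_det_effLapU_sub_le_volume {Z : Finset (Tor (fine L M) × Fin (d + 1))} (hZ : ∀ bd, bd ∉ Z → U bd = V bd) :
    |Real.log (RCLike.re (effLapU T M a c m2 U).det) - Real.log (RCLike.re (effLapU T M a c m2 V).det)|
      ≤ (8 * c * (Fintype.card n : ℝ) ^ 2 * (lapF (fine L M) c m2)⁻¹ 0 0 + a * (Fintype.card n : ℝ) * m2⁻¹) * Z.card := by
  have hG : 0 ≤ (lapF (fine L M) c m2)⁻¹ (0 : Tor (fine L M)) 0 := lapF_inv_entry_nonneg (fine L M) hc hm 0 0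
  have h1 := abs_log_re_det_effLapU_sub_le_local T M ha hc hm hU hV hZ
  have h2 := sum_norm_link_sub_le_of_eqOn (fine L M) hU hV hZ
  have h3 : 4 * c * (lapF (fine L M) c m2)⁻¹ 0 0 * (∑ b, ∑ i, ∑ j, ‖U b i j - V b i j‖)
      ≤ 4 * c * (lapF (fine L M) c m2)⁻¹ 0 0 * (2 * (Fintype.card n : ℝ) ^ 2 * Z.card) := mul_le_mul_of_nonneg_left h2 (by positivity)
  calc |Real.log (RCLike.re (effLapU T M a c m2 U).det) - Real.log (RCLike.re (effLapU T M a c m2 V).det)|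
      ≤ 4 * c * (lapF (fine L M) c m2)⁻¹ 0 0 * (2 * (Fintype.card n : ℝ) ^ 2 * Z.card) + a * ((Fintype.card n : ℝ) * Z.card * m2⁻¹) := h1.trans (add_le_add h3 le_rfl)
    _ = (8 * c * (Fintype.card n : ℝ) ^ 2 * (lapF (fine L M) c m2)⁻¹ 0 0 + a * (Fintype.card n : ℝ) * m2⁻¹) * Z.card := by ring

/-- ★ THE CRUDE (LOEWNER-FLOOR) FORM: `G(0,0) ≤ 1∕m²` ⟹ `≤ (8c|n|² + a|n|)·#Z∕m²` — `O(c∕m²)`, NOT η-uniform at King's scaling `c = L²`; PART Ϯ-e replaces `c·G(0,0)` by `5∕4 + (m²L²M₀⁴)⁻¹`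
in `d+1 = 4`. [cite: King1986, (2.14) p.653, (4.4) p.670] -/
theorem abs_log_re_det_effLapU_sub_le_volume_mass {Z : Finset (Tor (fine L M) × Fin (d + 1))} (hZ : ∀ bd, bd ∉ Z → U bd = V bd) :
    |Real.log (RCLike.re (effLapU T M a c m2 U).det) - Real.log (RCLike.re (effLapU T M a c m2 V).det)|
      ≤ (8 * c * (Fintype.card n : ℝ) ^ 2 * m2⁻¹ + a * (Fintype.card n : ℝ) * m2⁻¹) * Z.card :=
  (abs_log_re_det_effLapU_sub_le_volume T M ha hc hm hU hV hZ).trans (by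
    have := lapF_inv_diag_le_inv_mass (fine L M) hc hm (0 : Tor (fine L M))
    gcongr)

/-- ★★ **LOCAL AND GLOBAL TOGETHER**: the block-field shift is at most the SMALLER of Ϭ-b's global `N·ln(1+a∕m²)` (all `N = |T₁||n|` block degrees of freedom) and the volume law
`(8c|n|²G(0,0) + a|n|∕m²)·#Z` (only the changed bonds). [cite: King1986, (2.14) p.653, (3.89)–(3.90) pp.668–669, (4.33) p.674] -/
theorem abs_log_re_det_effLapU_sub_le_volume_min {Z : Finset (Tor (fine L M) × Fin (d + 1))} (hZ : ∀ bd, bd ∉ Z → U bd = V bd) :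
    |Real.log (RCLike.re (effLapU T M a c m2 U).det) - Real.log (RCLike.re (effLapU T M a c m2 V).det)|
      ≤ min (Fintype.card (Tor M × n) * Real.log (1 + a / m2))
          ((8 * c * (Fintype.card n : ℝ) ^ 2 * (lapF (fine L M) c m2)⁻¹ 0 0 + a * (Fintype.card n : ℝ) * m2⁻¹) * Z.card) :=
  le_min (abs_log_re_det_effLapU_sub_le T M ha hc hm hU hV) (abs_log_re_det_effLapU_sub_le_volume T M ha hc hm hU hV hZ)

end BlockField

/-! ## §1′ Relative to King's closed form at the flat background (King's scaling `c = L²`) -/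

section ClosedForm

variable {𝕜 : Type*} [RCLike 𝕜] {n : Type*} [Fintype n] [DecidableEq n]
variable (hL : 1 ≤ L) {a m2 : ℝ} (ha : 0 < a) (hm : 0 < m2)
variable {U : Tor (fine L M) × Fin (d + 1) → Matrix n n 𝕜} (hU : ∀ bd, U bd ∈ Matrix.unitaryGroup n 𝕜)
include hL ha hm hU

/-- ★★★ **WHAT THE CURVED CASE ADDS, LOCALLY**: at King's scaling `c = L²`, a unitary background `U` that is trivial off the bond set `Z` (`U(b) = 1` for `b ∉ Z`) moves the block-field
vacuum energy away from KING's CLOSED FORM `|n|·Σ_q ln effSym(q)` (Ϭ-i, (2.14)–(2.16)) by at most `(8L²|n|²G(0,0) + a|n|∕m²)·#Z` — a deviation proportional to the SUPPORT of the background,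
against Ϭ-i's global `N·ln(1+a∕m²)`. [cite: King1986, (2.14)–(2.16) p.653, (3.89)–(3.90) pp.668–669, (4.4)–(4.5) p.670, (4.33) p.674; Balaban1985BackgroundPropagators, (3.19) p.393, (3.42) p.397] -/
theorem abs_log_re_det_effLapU_sub_closedForm_le_volume {Z : Finset (Tor (fine L M) × Fin (d + 1))} (hZ : ∀ bd, bd ∉ Z → U bd = 1) :
    |Real.log (RCLike.re (effLapU T M a ((L : ℝ) ^ 2) m2 U).det) - Fintype.card n * ∑ q : Tor M, Real.log (effSym L M a ((L : ℝ) ^ 2) m2 q)|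
      ≤ (8 * (L : ℝ) ^ 2 * (Fintype.card n : ℝ) ^ 2 * (lapF (fine L M) ((L : ℝ) ^ 2) m2)⁻¹ 0 0 + a * (Fintype.card n : ℝ) * m2⁻¹) * Z.card := by
  rw [← log_re_det_effLapU_flat T M hL ha hm (𝕜 := 𝕜) (n := n)]
  exact abs_log_re_det_effLapU_sub_le_volume T M ha (by positivity) hm hU (flat_mem_unitaryGroup (L := L) (d := d) M (n := n) (𝕜 := 𝕜)) (V := fun _ => 1) hZ

end ClosedForm

/-! ## §2 King's `E₀ = ln 𝒩(Δ_eff)` ((3.89)) moves by half of it (`𝕜 = ℝ`) -/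

section Gauss

variable {n : Type*} [Fintype n] [DecidableEq n] [Nonempty n]
variable {a c m2 : ℝ} (ha : 0 < a) (hc : 0 ≤ c) (hm : 0 < m2)
variable {U V : Tor (fine L M) × Fin (d + 1) → Matrix n n ℝ} (hU : ∀ bd, U bd ∈ Matrix.unitaryGroup n ℝ) (hV : ∀ bd, V bd ∈ Matrix.unitaryGroup n ℝ)
include ha hc hm hU hV

/-- ★★★ **THE VOLUME LAW FOR KING's (3.89) NORMALISATION**: `|ln 𝒩(Δ_eff(U)) − ln 𝒩(Δ_eff(V))| ≤ ½(8c|n|²G(0,0) + a|n|∕m²)·#Z` for real-orthogonal backgrounds that agree off `Z`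
(`ln 𝒩 = ½N ln 2π − ½ ln det`, Ϭ-b `log_gaussNorm_effLapU`). [cite: King1986, (2.6) p.652, (3.89)–(3.90) pp.668–669, (4.33) p.674] -/
theorem abs_log_gaussNorm_effLapU_sub_le_volume {Z : Finset (Tor (fine L M) × Fin (d + 1))} (hZ : ∀ bd, bd ∉ Z → U bd = V bd) :
    |Real.log (gaussNorm (effLapU T M a c m2 U)) - Real.log (gaussNorm (effLapU T M a c m2 V))|
      ≤ 1 / 2 * ((8 * c * (Fintype.card n : ℝ) ^ 2 * (lapF (fine L M) c m2)⁻¹ 0 0 + a * (Fintype.card n : ℝ) * m2⁻¹) * Z.card) := by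
  have h := abs_log_re_det_effLapU_sub_le_volume T M ha hc hm hU hV hZ
  simp only [RCLike.re_to_real] at h
  rw [log_gaussNorm_effLapU T M ha hc hm hU, log_gaussNorm_effLapU T M ha hc hm hV]
  have e : (Fintype.card (Tor M × n) : ℝ) / 2 * Real.log (2 * Real.pi) - 1 / 2 * Real.log (effLapU T M a c m2 U).det
      - ((Fintype.card (Tor M × n) : ℝ) / 2 * Real.log (2 * Real.pi) - 1 / 2 * Real.log (effLapU T M a c m2 V).det)
      = -(1 / 2) * (Real.log (effLapU T M a c m2 U).det - Real.log (effLapU T M a c m2 V).det) := by ring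
  rw [e, abs_mul, abs_neg, abs_of_pos (by norm_num : (0 : ℝ) < 1 / 2)]
  exact mul_le_mul_of_nonneg_left h (by norm_num)

end Gauss

/-! ## §3 Package -/

section Package

variable {𝕜 : Type*} [RCLike 𝕜] {n : Type*} [Fintype n] [DecidableEq n]
variable {a c m2 : ℝ} (ha : 0 < a) (hc : 0 ≤ c) (hm : 0 < m2)
variable {U V : Tor (fine L M) × Fin (d + 1) → Matrix n n 𝕜} (hU : ∀ bd, U bd ∈ Matrix.unitaryGroup n 𝕜) (hV : ∀ bd, V bd ∈ Matrix.unitaryGroup n 𝕜)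
include ha hc hm hU hV

/-- ★★★★ **THE VOLUME LAW FOR KING's THREE ONE-LEVEL GAUSSIAN NORMALISATIONS** (PART Ϯ package): for unitary backgrounds that agree off the bond set `Z`, with `G(0,0) = (lapF)⁻¹(0,0)`
King's `A = 0` covariance at coinciding points: (i) fine `|Δ ln det(−cΔ_U+m²)| ≤ 4c|n|²G(0,0)·#Z`; (ii) with the block term `|Δ ln det A₀| ≤ (4c|n|²G(0,0) + a|n|∕m²)·#Z`; (iii) NE2's unit layer
`|Δ ln det Δ_eff| ≤ (8c|n|²G(0,0) + a|n|∕m²)·#Z`; (iv) and never more than Ϭ-b's global `N·ln(1+a∕m²)`.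
[cite: King1986, (2.13)–(2.14) p.653, (3.89)–(3.90) pp.668–669, (4.4)–(4.5) p.670; Balaban1985BackgroundPropagators, (3.19) p.393, (3.23)–(3.25) p.394, (3.42) p.397] -/
theorem king_volume_law_package {Z : Finset (Tor (fine L M) × Fin (d + 1))} (hZ : ∀ bd, bd ∉ Z → U bd = V bd) :
    |Real.log (RCLike.re (covLapF (fine L M) c m2 U).det) - Real.log (RCLike.re (covLapF (fine L M) c m2 V).det)|
        ≤ 4 * c * (Fintype.card n : ℝ) ^ 2 * (lapF (fine L M) c m2)⁻¹ 0 0 * Z.card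
    ∧ |Real.log (RCLike.re (fullOpU T M a c m2 U).det) - Real.log (RCLike.re (fullOpU T M a c m2 V).det)|
        ≤ (4 * c * (Fintype.card n : ℝ) ^ 2 * (lapF (fine L M) c m2)⁻¹ 0 0 + a * (Fintype.card n : ℝ) * m2⁻¹) * Z.card
    ∧ |Real.log (RCLike.re (effLapU T M a c m2 U).det) - Real.log (RCLike.re (effLapU T M a c m2 V).det)|
        ≤ (8 * c * (Fintype.card n : ℝ) ^ 2 * (lapF (fine L M) c m2)⁻¹ 0 0 + a * (Fintype.card n : ℝ) * m2⁻¹) * Z.card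
    ∧ |Real.log (RCLike.re (effLapU T M a c m2 U).det) - Real.log (RCLike.re (effLapU T M a c m2 V).det)|
        ≤ Fintype.card (Tor M × n) * Real.log (1 + a / m2) :=
  ⟨abs_log_re_det_covLapF_sub_le_volume (fine L M) hc hm hU hV hZ, abs_log_re_det_fullOpU_sub_le_volume T M ha.le hc hm hU hV hZ,
    abs_log_re_det_effLapU_sub_le_volume T M ha hc hm hU hV hZ, abs_log_re_det_effLapU_sub_le T M ha hc hm hU hV⟩

end Package

end Summit.QuantumFields.YangMills.BalabanUVNodes.N15KingModelRung.Analytic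

end
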